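import Literature.Analysis.FunctionSpaces.LatticeSobolev
import Mathlib.Analysis.SpecialFunctions.Trigonometric.Bounds
import Mathlib.Analysis.SpecialFunctions.ExpDeriv
import Mathlib.MeasureTheory.Integral.Lebesgue.Add
import HarnessLib

/-!
# The Sobolev scale on the frequency lattice `ℤ^d`, part Ib: derivatives and difference quotients
# (Warner 6.17–6.20)

Continuation of `LatticeSobolev.lean` (sequence-level Sobolev norms `Lattice.eNormSq s c`,
`Lattice.eNorm s c` of coefficient families `c : ℤ^d → V`; F. W. Warner, *Foundations of
Differentiable Manifolds and Lie Groups*, GTM 94 (1983), Ch. 6). Here: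

* the derivative multipliers `Lattice.freqDeriv j c = (2πi k_j) • c` — the coefficients of `∂_j`
  on the unit torus (tree convention `Torus.mFourierCoeff_partialDeriv`; Warner 6.17:
  "`(D^α u)_ξ = ξ^α u_ξ`", extended to every coefficient family = Warner's `S`): `∂_j` has order
  one, `‖∂_j c‖²_s ≤ (2π)² ‖c‖²_{s+1}` (6.18 (h)), and the exact splitting
  `‖c‖²_{s+1} = ‖c‖²_s + (2π)⁻² ∑_j ‖∂_j c‖²_s` (`Lattice.eNormSq_add_one`), whence
  `c ∈ H_{s+1} ↔ c ∈ H_s ∧ ∀ j, ∂_j c ∈ H_s`;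
* difference quotients `Lattice.diffQuot j t c = ((e^{2πi k_j t} - 1)/t) • c` along the coordinate
  directions (Warner 6.19 (2)): `‖c^t‖²_s ≤ ‖∂_j c‖²_s ≤ (2π)²‖c‖²_{s+1}` uniformly in `t`
  (6.19 (4)–(5)), the multipliers converge to `2πi k_j` (6.20 (2)), and **Warner's Lemma 6.20**:
  a bound `‖c^{t_n}‖²_s ≤ K` along steps `t_n → 0` gives `‖∂_j c‖²_s ≤ K` (Fatou's lemma for the
  counting measure on `ℤ^d`), so that bounded difference quotients in every direction put an
  element of `H_s` into `H_{s+1}`.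

All statements are proved; values in `ℝ≥0∞`, no summability hypotheses.

## References

* F. W. Warner, *Foundations of Differentiable Manifolds and Lie Groups*, GTM 94 (1983), 6.17,
  6.18 (a), (h), 6.19, Lemma 6.20. [WarnerGTM94]
-/

open MeasureTheory Filter
open scoped ENNReal NNReal Topology

noncomputable section

namespace Literature.Analysis.FunctionSpaces

namespace Lattice

open Torus

variable {d : Type*}
variable {V W : Type*} [NormedAddCommGroup V] [NormedAddCommGroup W]


/-! ## Derivatives as multipliers -/

section Deriv

variable [NormedSpace ℂ V]

/-- The **frequency-side partial derivative** `∂_j`: `(∂_j c)(k) = (2πi k_j) • c k`, the action of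
`∂/∂x_j` on Fourier coefficients of functions on the unit torus `T^d` (tree convention
`Torus.mFourierCoeff_partialDeriv`; Warner (1983), 6.17: "`(D^α u)_ξ = ξ^α u_ξ`", there for period
`2π`). Defined for every coefficient family — Warner's extension of `D^α` to all of `S`.
[cite: WarnerGTM94, 6.17] -/
def freqDeriv (j : d) (c : (d → ℤ) → V) : (d → ℤ) → V := fun k =>
  (2 * Real.pi * Complex.I * (k j)) • c k

/-- Unfolding of `freqDeriv`. [folklore] -/
@[simp] theorem freqDeriv_apply (j : d) (c : (d → ℤ) → V) (k : d → ℤ) :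
    freqDeriv j c k = (2 * Real.pi * Complex.I * (k j)) • c k := rfl

/-- `∂_j 0 = 0`. [folklore] -/
@[simp] theorem freqDeriv_zero (j : d) : freqDeriv j (0 : (d → ℤ) → V) = 0 := by
  funext k; simp

/-- `∂_j (c + c') = ∂_j c + ∂_j c'`. [folklore] -/
theorem freqDeriv_add (j : d) (c c' : (d → ℤ) → V) :
    freqDeriv j (c + c') = freqDeriv j c + freqDeriv j c' := by
  funext k; simp [smul_add]

/-- `∂_j (c - c') = ∂_j c - ∂_j c'`. [folklore] -/
theorem freqDeriv_sub (j : d) (c c' : (d → ℤ) → V) :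
    freqDeriv j (c - c') = freqDeriv j c - freqDeriv j c' := by
  funext k; simp [smul_sub]

/-- `∂_j (-c) = -∂_j c`. [folklore] -/
theorem freqDeriv_neg (j : d) (c : (d → ℤ) → V) : freqDeriv j (-c) = -freqDeriv j c := by
  funext k; simp

/-- `∂_j (a • c) = a • ∂_j c`. [folklore] -/
theorem freqDeriv_const_smul (j : d) (a : ℂ) (c : (d → ℤ) → V) :
    freqDeriv j (a • c) = a • freqDeriv j c := by
  funext k; simp [smul_comm a]

/-- Derivatives in different directions commute. [folklore] -/
theorem freqDeriv_comm (i j : d) (c : (d → ℤ) → V) :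
    freqDeriv i (freqDeriv j c) = freqDeriv j (freqDeriv i c) := by
  funext k; simp [smul_smul, mul_comm]

/-- `‖2πi k_j‖ = 2π |k_j|`. [folklore] -/
theorem norm_two_pi_I_mul (k : d → ℤ) (j : d) :
    ‖(2 * Real.pi * Complex.I * (k j) : ℂ)‖ = 2 * Real.pi * |(k j : ℝ)| := by
  simp [abs_of_pos Real.pi_pos]

/-- `‖(∂_j c)(k)‖ = 2π |k_j| ‖c k‖`. [folklore] -/
theorem norm_freqDeriv_apply (j : d) (c : (d → ℤ) → V) (k : d → ℤ) :
    ‖freqDeriv j c k‖ = 2 * Real.pi * |(k j : ℝ)| * ‖c k‖ := by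
  rw [freqDeriv_apply, norm_smul, norm_two_pi_I_mul]

variable [Fintype d]

/-- `∂_j` is an operator of order one: `‖∂_j c‖²_s ≤ (2π)² ‖c‖²_{s+1}` (Warner 6.18 (h)).
[cite: WarnerGTM94, 6.18 (h)] -/
theorem eNormSq_freqDeriv_le (s : ℝ) (j : d) (c : (d → ℤ) → V) :
    eNormSq s (freqDeriv j c) ≤ ENNReal.ofReal ((2 * Real.pi) ^ 2) * eNormSq (s + 1) c :=
  eNormSq_le_of_norm_le (by positivity) fun k => by
    rw [norm_freqDeriv_apply]
    gcongr
    exact abs_apply_le_sobolevWeight_one k j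

/-- `‖∂_j c‖_s ≤ 2π ‖c‖_{s+1}`. [cite: WarnerGTM94, 6.18 (h)] -/
theorem eNorm_freqDeriv_le (s : ℝ) (j : d) (c : (d → ℤ) → V) :
    eNorm s (freqDeriv j c) ≤ ENNReal.ofReal (2 * Real.pi) * eNorm (s + 1) c :=
  eNorm_le_of_norm_le (by positivity) fun k => by
    rw [norm_freqDeriv_apply]
    gcongr
    exact abs_apply_le_sobolevWeight_one k j

/-- The term of `‖∂_j c‖²_s` at `k`: `⟨k⟩^{2s} ‖(∂_j c) k‖² = (2π)² k_j² ⟨k⟩^{2s} ‖c k‖²`. [folklore] -/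
theorem term_freqDeriv (s : ℝ) (j : d) (c : (d → ℤ) → V) (k : d → ℤ) :
    ENNReal.ofReal (sobolevWeight s k ^ 2) * ‖freqDeriv j c k‖ₑ ^ 2 =
      ENNReal.ofReal ((2 * Real.pi) ^ 2) *
        (ENNReal.ofReal (sobolevWeight s k ^ 2 * (k j : ℝ) ^ 2) * ‖c k‖ₑ ^ 2) := by
  have h1 : ‖freqDeriv j c k‖ₑ = ENNReal.ofReal (2 * Real.pi * |(k j : ℝ)|) * ‖c k‖ₑ := by
    rw [← ofReal_norm, norm_freqDeriv_apply, ENNReal.ofReal_mul (by positivity), ofReal_norm]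
  rw [h1, mul_pow, ← ENNReal.ofReal_pow (by positivity), ENNReal.ofReal_mul (sq_nonneg _),
    mul_pow, sq_abs, ENNReal.ofReal_mul (by positivity)]
  ring

/-- **Splitting of the `H_{s+1}` norm**: `‖c‖²_{s+1} = ‖c‖²_s + (2π)⁻² ∑_j ‖∂_j c‖²_s`
(since `⟨k⟩^{2(s+1)} = ⟨k⟩^{2s}(1 + ∑_j k_j²)`; Warner 6.18 (a)/(1) for one derivative, here an
identity thanks to the spectral normalisation). [cite: WarnerGTM94, 6.18 (a)] -/
theorem eNormSq_add_one (s : ℝ) (c : (d → ℤ) → V) :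
    eNormSq (s + 1) c =
      eNormSq s c + (ENNReal.ofReal ((2 * Real.pi) ^ 2))⁻¹ * ∑ j, eNormSq s (freqDeriv j c) := by
  have hπ : ENNReal.ofReal ((2 * Real.pi) ^ 2) ≠ 0 := by positivity
  have hπ' : ENNReal.ofReal ((2 * Real.pi) ^ 2) ≠ ∞ := ENNReal.ofReal_ne_top
  -- rewrite the derivative terms
  have hD : ∑ j, eNormSq s (freqDeriv j c) = ENNReal.ofReal ((2 * Real.pi) ^ 2) *
      ∑' k, ENNReal.ofReal (sobolevWeight s k ^ 2 * freqNormSq k) * ‖c k‖ₑ ^ 2 := by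
    simp only [eNormSq, term_freqDeriv, ENNReal.tsum_mul_left, ← Finset.mul_sum]
    congr 1
    rw [← tsum_finsetSum_comm]
    refine tsum_congr fun k => ?_
    rw [← Finset.sum_mul, ← ENNReal.ofReal_sum_of_nonneg (fun i _ => by positivity),
      ← Finset.mul_sum]
    rfl
  rw [hD, ← mul_assoc, ENNReal.inv_mul_cancel hπ hπ', one_mul, eNormSq, eNormSq, ← ENNReal.tsum_add]
  refine tsum_congr fun k => ?_
  rw [← add_mul, ← ENNReal.ofReal_add (sq_nonneg _) (by positivity [freqNormSq_nonneg k]),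
    sobolevWeight_add, mul_pow, sobolevWeight_one_sq]
  ring_nf

/-- In particular `‖c‖²_{s+1} ≤ ‖c‖²_s + (2π)⁻² ∑_j ‖∂_j c‖²_s` read as: `c ∈ H_s` with all
`∂_j c ∈ H_s` gives `c ∈ H_{s+1}`. [cite: WarnerGTM94, 6.18 (a)] -/
theorem eNormSq_add_one_lt_top {s : ℝ} {c : (d → ℤ) → V} (h0 : eNormSq s c < ∞)
    (h1 : ∀ j, eNormSq s (freqDeriv j c) < ∞) : eNormSq (s + 1) c < ∞ := by
  rw [eNormSq_add_one]
  refine ENNReal.add_lt_top.2 ⟨h0, ENNReal.mul_lt_top (ENNReal.inv_lt_top.2 (by positivity)) ?_⟩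
  exact (ENNReal.sum_lt_top.2 fun j _ => h1 j)

/-- Conversely each `‖∂_j c‖²_s ≤ (2π)² ‖c‖²_{s+1}` — recorded as the finiteness statement.
[cite: WarnerGTM94, 6.18 (h)] -/
theorem eNormSq_freqDeriv_lt_top {s : ℝ} {c : (d → ℤ) → V} (h : eNormSq (s + 1) c < ∞) (j : d) :
    eNormSq s (freqDeriv j c) < ∞ :=
  (eNormSq_freqDeriv_le s j c).trans_lt (ENNReal.mul_lt_top ENNReal.ofReal_lt_top h)

end Deriv

/-! ## Difference quotients (Warner 6.19–6.20) -/

section DiffQuot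

variable [NormedSpace ℂ V]

/-- The multiplier of the difference quotient along the `j`-th coordinate direction with real
step `t`: `(e^{2πi k_j t} - 1)/t` (Warner (1983), 6.19 (2), for the unit torus).
[cite: WarnerGTM94, 6.19 (2)] -/
def diffQuotMul (j : d) (t : ℝ) (k : d → ℤ) : ℂ :=
  (Complex.exp (2 * Real.pi * Complex.I * (k j) * t) - 1) / t

/-- The **difference quotient** `c^t = (T_{t e_j} c - c)/t` of a coefficient family along `e_j`
(Warner (1983), 6.19 (2)): the multiplier `diffQuotMul j t`. [cite: WarnerGTM94, 6.19 (2)] -/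
def diffQuot (j : d) (t : ℝ) (c : (d → ℤ) → V) : (d → ℤ) → V := fun k => diffQuotMul j t k • c k

/-- Unfolding of `diffQuot`. [folklore] -/
@[simp] theorem diffQuot_apply (j : d) (t : ℝ) (c : (d → ℤ) → V) (k : d → ℤ) :
    diffQuot j t c k = diffQuotMul j t k • c k := rfl

/-- Difference quotients are additive. [folklore] -/
theorem diffQuot_add (j : d) (t : ℝ) (c c' : (d → ℤ) → V) :
    diffQuot j t (c + c') = diffQuot j t c + diffQuot j t c' := by
  funext k; simp [smul_add]

/-- Difference quotients commute with subtraction. [folklore] -/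
theorem diffQuot_sub (j : d) (t : ℝ) (c c' : (d → ℤ) → V) :
    diffQuot j t (c - c') = diffQuot j t c - diffQuot j t c' := by
  funext k; simp [smul_sub]

/-- Difference quotients commute with scalars. [folklore] -/
theorem diffQuot_const_smul (j : d) (t : ℝ) (a : ℂ) (c : (d → ℤ) → V) :
    diffQuot j t (a • c) = a • diffQuot j t c := by
  funext k; simp [smul_comm a]

/-- Difference quotients commute with derivatives (both are multipliers). [folklore] -/
theorem freqDeriv_diffQuot (i j : d) (t : ℝ) (c : (d → ℤ) → V) :
    freqDeriv i (diffQuot j t c) = diffQuot j t (freqDeriv i c) := by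
  funext k; simp [smul_smul, mul_comm]

/-- `|e^{2πi k_j t} - 1|/|t| ≤ 2π |k_j|` (Warner 6.19 (4): "`4 sin²(½ h·ξ)/|h|² ≤ (h·ξ)²/|h|²`").
[cite: WarnerGTM94, 6.19 (4)] -/
theorem norm_diffQuotMul_le (j : d) (t : ℝ) (k : d → ℤ) :
    ‖diffQuotMul j t k‖ ≤ 2 * Real.pi * |(k j : ℝ)| := by
  rcases eq_or_ne t 0 with rfl | ht
  · simp [diffQuotMul]; positivity
  rw [diffQuotMul, norm_div, Complex.norm_real, Real.norm_eq_abs, div_le_iff₀ (abs_pos.2 ht)]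
  have h := Real.norm_exp_I_mul_ofReal_sub_one_le (x := 2 * Real.pi * (k j) * t)
  rw [Real.norm_eq_abs] at h
  calc ‖Complex.exp (2 * Real.pi * Complex.I * (k j) * t) - 1‖
      = ‖Complex.exp (Complex.I * (2 * Real.pi * (k j : ℝ) * t : ℝ)) - 1‖ := by
        congr 2; push_cast; ring
    _ ≤ |2 * Real.pi * (k j : ℝ) * t| := h
    _ = 2 * Real.pi * |(k j : ℝ)| * |t| := by
        rw [abs_mul, abs_mul, abs_mul, abs_of_pos Real.pi_pos, abs_two]

/-- The multipliers converge to the symbol of `∂_j`: `(e^{2πi k_j t} - 1)/t → 2πi k_j` as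
`t → 0`, `t ≠ 0` (Warner 6.20 (2)). [cite: WarnerGTM94, 6.20 (2)] -/
theorem tendsto_diffQuotMul (j : d) (k : d → ℤ) :
    Tendsto (fun t : ℝ => diffQuotMul j t k) (𝓝[≠] 0) (𝓝 (2 * Real.pi * Complex.I * (k j))) := by
  -- derivative at `0` of `t ↦ exp (a t)` with `a = 2πi k_j`
  set a : ℂ := 2 * Real.pi * Complex.I * (k j) with ha
  have h1 : HasDerivAt (fun t : ℝ => a * (t : ℂ)) a 0 := by
    simpa using ((hasDerivAt_id (0 : ℝ)).ofReal_comp).const_mul a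
  have hd : HasDerivAt (fun t : ℝ => Complex.exp (a * (t : ℂ))) a 0 := by
    simpa using h1.cexp
  have := hd.tendsto_slope_zero
  refine this.congr' (eventually_nhdsWithin_of_forall fun t _ => ?_)
  simp only [zero_add, Complex.ofReal_zero, mul_zero, Complex.exp_zero, diffQuotMul]
  rw [Complex.real_smul, Complex.ofReal_inv, div_eq_inv_mul, ha, mul_assoc]

variable [Fintype d]

/-- `‖c^t‖ ≤ ‖∂_j c‖` termwise, hence `‖c^t‖²_s ≤ ‖∂_j c‖²_s ≤ (2π)²‖c‖²_{s+1}` uniformly in `t`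
(Warner 6.19 (5)). [cite: WarnerGTM94, 6.19 (5)] -/
theorem eNormSq_diffQuot_le (s : ℝ) (j : d) (t : ℝ) (c : (d → ℤ) → V) :
    eNormSq s (diffQuot j t c) ≤ eNormSq s (freqDeriv j c) :=
  eNormSq_le_of_norm_le_norm fun k => by
    rw [diffQuot_apply, norm_smul, norm_freqDeriv_apply]
    exact mul_le_mul_of_nonneg_right (norm_diffQuotMul_le j t k) (norm_nonneg _)

/-- `‖c^t‖²_s ≤ (2π)² ‖c‖²_{s+1}` uniformly in `t` (Warner 6.19 (5)). [cite: WarnerGTM94, 6.19 (5)] -/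
theorem eNormSq_diffQuot_le' (s : ℝ) (j : d) (t : ℝ) (c : (d → ℤ) → V) :
    eNormSq s (diffQuot j t c) ≤ ENNReal.ofReal ((2 * Real.pi) ^ 2) * eNormSq (s + 1) c :=
  (eNormSq_diffQuot_le s j t c).trans (eNormSq_freqDeriv_le s j c)

/-- **Warner's Lemma 6.20** (converse to 6.19 (5)): if the difference quotients of `c` along `e_j`
are bounded in `H_s` along some sequence of steps `t_n → 0` (`t_n ≠ 0`), `‖c^{t_n}‖²_s ≤ K`, then
`‖∂_j c‖²_s ≤ K`; with `eNormSq_add_one`, `c ∈ H_{s+1}` as soon as this holds for every `j` and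
`c ∈ H_s`. Proof: Fatou's lemma for the counting measure on `ℤ^d`, the terms converging by
`tendsto_diffQuotMul`. [cite: WarnerGTM94, Lemma 6.20] -/
theorem eNormSq_freqDeriv_le_of_diffQuot {s : ℝ} {j : d} {c : (d → ℤ) → V} {K : ℝ≥0∞}
    {t : ℕ → ℝ} (ht : Tendsto t atTop (𝓝[≠] 0)) (hK : ∀ n, eNormSq s (diffQuot j (t n) c) ≤ K) :
    eNormSq s (freqDeriv j c) ≤ K := by
  -- termwise convergence
  have hterm : ∀ k, Tendsto (fun n => ENNReal.ofReal (sobolevWeight s k ^ 2) *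
      ‖diffQuot j (t n) c k‖ₑ ^ 2) atTop
      (𝓝 (ENNReal.ofReal (sobolevWeight s k ^ 2) * ‖freqDeriv j c k‖ₑ ^ 2)) := fun k => by
    have h1 : Tendsto (fun n => diffQuot j (t n) c k) atTop (𝓝 (freqDeriv j c k)) := by
      simp only [diffQuot_apply, freqDeriv_apply]
      exact ((tendsto_diffQuotMul j k).comp ht).smul_const (c k)
    have h2 : Tendsto (fun n => (‖diffQuot j (t n) c k‖₊ : ℝ≥0∞) ^ 2) atTop
        (𝓝 ((‖freqDeriv j c k‖₊ : ℝ≥0∞) ^ 2)) := by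
      have h3 := ENNReal.tendsto_coe.2 (h1.nnnorm.pow 2)
      simpa only [ENNReal.coe_pow] using h3
    simpa only [enorm_eq_nnnorm] using ENNReal.Tendsto.const_mul h2 (Or.inr ENNReal.ofReal_ne_top)
  calc eNormSq s (freqDeriv j c)
      = ∫⁻ k, liminf (fun n => ENNReal.ofReal (sobolevWeight s k ^ 2) *
          ‖diffQuot j (t n) c k‖ₑ ^ 2) atTop ∂Measure.count := by
        rw [lintegral_count, eNormSq]
        exact tsum_congr fun k => ((hterm k).liminf_eq).symm
    _ ≤ liminf (fun n => ∫⁻ k, ENNReal.ofReal (sobolevWeight s k ^ 2) *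
          ‖diffQuot j (t n) c k‖ₑ ^ 2 ∂Measure.count) atTop :=
        lintegral_liminf_le fun n => Measurable.of_discrete
    _ ≤ K := by
        refine liminf_le_of_le (by isBoundedDefault) fun b hb => ?_
        obtain ⟨n, hn⟩ := hb.exists
        exact hn.trans (by rw [lintegral_count]; exact hK n)

/-- The standard sequence of steps `t_n = 1/(n+1) → 0`, `t_n ≠ 0`, for use in
`eNormSq_freqDeriv_le_of_diffQuot`. [folklore] -/
theorem tendsto_one_div_add_one_nhdsWithin :
    Tendsto (fun n : ℕ => (1 : ℝ) / (n + 1)) atTop (𝓝[≠] 0) :=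
  tendsto_nhdsWithin_iff.2 ⟨tendsto_one_div_add_atTop_nhds_zero_nat,
    Eventually.of_forall fun n => by rw [Set.mem_compl_singleton_iff]; positivity⟩

end DiffQuot

end Lattice

end Literature.Analysis.FunctionSpaces
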